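import Mathlib
import HarnessLib
import Literature.AlgebraicGeometry.Ramification.InertiaNormalSylow

/-!
# The locus where a group element is inert is closed (crux `WildQuotients.WildQuotientResolution`, line `Sketch`)

Stub `stub_isClosed_inertiaLocus` of the skeleton `Sketch` for crux stmt-ResolutionOfSingularities-15640
(route `ResolutionOfSingularities/WildQuotients`, card `p-closure-sylow-separation`): for an action
`ρ` of a group `G` on a scheme `X′` by automorphisms OVER `X₁` through an affine (hence separated)
morphism `q : X′ ⟶ X₁` (`ρ g ≫ q = q`) and an element `h ∈ G`, the "inert locus"
`{x ∈ X′ | h ∈ I_x}` — `I_x` the inertia group of Abbes–Saito 2011, 2.4, the tree's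
`Literature.AlgebraicGeometry.Ramification.inertiaSubgroup ρ x`: `h` fixes the canonical point
`Spec κ(x) → X′`, i.e. `h x = x` and `h` acts trivially on `κ(x)` — is closed. Phase 0 ("Sylow
separation") of the wild-quotient resolution uses it to see that the non-`p`-closed locus of a
regular `G`-surface is closed.

Proof. Let `e : E ⟶ X′` be (the underlying morphism of) the equaliser of `ρ h` and `𝟙` in the
category of schemes over `X₁`; as `q` is affine, hence separated, `e` is a closed immersion
(Mathlib's `isClosedImmersion_equalizer_ι_left`, Stacks 01KM), so its range is closed. The range is
exactly the inert locus: if `Spec κ(x) → X′` is fixed by `ρ h` it factors through `E` (universal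
property), so `x` is in the range; conversely for `z ∈ E`,
`Spec κ(z) → Spec κ(e z) → X′ = Spec κ(z) → E → X′`
(`Scheme.Hom.SpecMap_residueFieldMap_fromSpecResidueField`) is fixed by `ρ h` (equaliser condition)
and `Spec κ(z) → Spec κ(e z)` is an epimorphism (`epi_SpecMap_residueField`), so `Spec κ(e z) → X′`
is fixed by `ρ h`.
-/

-- single-problem summit: the doubled namespace component `ResolutionOfSingularities` is forced
set_option linter.dupNamespace false

namespace Summit.ResolutionOfSingularities.ResolutionOfSingularities.Theorems.WildQuotientResolution.InertiaLocus

open CategoryTheory CategoryTheory.Limits AlgebraicGeometry Literature.AlgebraicGeometry.Ramification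

/-- **The locus where a given group element is inert is closed**: for an action `ρ` of `G` on `X′`
over `X₁` through the affine (hence separated) `q` (`ρ g ≫ q = q`) and `h ∈ G`, the set
`{x | h ∈ I_x}` (`I_x = inertiaSubgroup ρ x`: `Spec κ(x) → X′` is fixed by `ρ h`) is closed — it is
the range of the equaliser of `ρ h` and `𝟙 X′` over `X₁`, a closed immersion since `q` is separated.
[folklore; cf. AbbesSaito2011, 2.4; Stacks 01KM] -/
theorem stub_isClosed_inertiaLocus {X' X₁ : Scheme.{0}} (q : X' ⟶ X₁) [IsAffineHom q]
    {G : Type} [Group G] (ρ : G →* Aut X') (hρ : ∀ g : G, (ρ g).hom ≫ q = q) (h : G) :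
    IsClosed {x : X' | h ∈ inertiaSubgroup ρ x} := by
  -- the equaliser `e : E ⟶ X'` of `ρ h` and `𝟙 X'` in the category of schemes over `X₁`
  let Y' : Over X₁ := Over.mk q
  let f' : Y' ⟶ Y' := Over.homMk (ρ h).hom (hρ h)
  let g' : Y' ⟶ Y' := 𝟙 Y'
  have : IsSeparated Y'.hom := inferInstanceAs (IsSeparated q)
  let e : (equalizer f' g').left ⟶ X' := (equalizer.ι f' g').left
  haveI : IsClosedImmersion e := isClosedImmersion_equalizer_ι_left f' g'
  have hcond : e ≫ (ρ h).hom = e := by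
    have hc := congr($(equalizer.condition f' g').left)
    rw [Over.comp_left, Over.comp_left] at hc
    exact hc.trans (Category.comp_id _)
  suffices H : {x : X' | h ∈ inertiaSubgroup ρ x} = Set.range e.base by
    rw [H]
    exact e.isClosedEmbedding.isClosed_range
  ext x
  rw [Set.mem_setOf_eq, mem_inertiaSubgroup_iff, Set.mem_range]
  constructor
  · -- a point whose canonical morphism is fixed by `ρ h` factors through the equaliser
    intro hx
    let P : Over X₁ := Over.mk (X'.fromSpecResidueField x ≫ q)
    let i' : P ⟶ Y' := Over.homMk (X'.fromSpecResidueField x) rfl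
    have hi : i' ≫ f' = i' ≫ g' := by
      ext1
      rw [Over.comp_left, Over.comp_left]
      exact hx.trans (Category.comp_id _).symm
    have h1 : (equalizer.lift i' hi).left ≫ e = X'.fromSpecResidueField x :=
      congr($(equalizer.lift_ι i' hi).left)
    refine ⟨(equalizer.lift i' hi).left.base (IsLocalRing.closedPoint (X'.residueField x)), ?_⟩
    rw [← Scheme.Hom.comp_apply, h1]
    exact Scheme.fromSpecResidueField_apply x _
  · -- a point of the equaliser is inert: cancel the epimorphism `Spec κ(z) → Spec κ(e z)`
    rintro ⟨z, rfl⟩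
    haveI := epi_SpecMap_residueField (Y := X') (e.base z) (e.residueFieldMap z)
    rw [← cancel_epi (Spec.map (e.residueFieldMap z)),
      Scheme.Hom.SpecMap_residueFieldMap_fromSpecResidueField_assoc,
      Scheme.Hom.SpecMap_residueFieldMap_fromSpecResidueField, hcond]

end Summit.ResolutionOfSingularities.ResolutionOfSingularities.Theorems.WildQuotientResolution.InertiaLocus
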